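import Literature.NumberTheory.EllipticCurves.Hsieh2014.AnticyclotomicPAdicLFunctionRamifiedSteinberg
import Literature.NumberTheory.EllipticCurves.QuadraticTwist
import Literature.NumberTheory.DiophantineGeometry.LocalReduction
import HarnessLib

/-!
# Hsieh 2014, Theorems A and B (= Thm. 1–2 of the e-print) for a curve ADDITIVE at the `K`-RAMIFIED prime `ℓ₀` with
# `E/K_{λ₀}` NON-SPLIT MULTIPLICATIVE — `𝔫⁻ = ℓ₀ ∥ N_g` for `g = f_E ⊗ χ_{ℓ₀*} = f_{W₁}`, branch `λ = ν·λ_E` with `ν` the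
# genus character —, every other `ℓ ∣ N` split in `K`, any level at `p`: two named facts, the E3′ siblings of
# `thmA_exists_isHsiehLFunction_unrPeriod_ramifiedSteinberg` / `thmB_exists_isHsiehLFunction_coeff_norm_eq_one_unrPeriod_ramifiedSteinberg`
# with the binder "`W` multiplicative, not split multiplicative at `q`" (`q ∥ N`) REPLACED by the twisted configuration (S4‴)

Topic `NumberTheory/EllipticCurves`, sub-directory `Hsieh2014` (namespace = path). Companion of
`Hsieh2014/AnticyclotomicPAdicLFunctionRamifiedSteinberg.lean` (configuration (S4′): ONE `K`-ramified STEINBERG prime `q ∥ N`,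
`a_q = −1`), whose module docstring — the print reading at the ramified place, (sf), Hypothesis 1 ⟺ (R1), `λ_𝔮 = 1`,
the honesty of the display at `𝔮`, `C(π, λ)` a unit, `𝔑⁻`, `𝔠(𝒪_K)` — is used VERBATIM for the pair `(π_g, ν·λ)` below and
not restated; the frame `IsHsiehLFunction`, the display `hsiehInterpolationValue`, (S1)–(S8), (W1)–(W4), (E1)–(E2), (E1″) are the
frame file's (`AnticyclotomicRankinSelbergPAdicLFunction.lean`). Ledger item wi-99843 (director-bsd ruling (661)(A)(a), WANTED row R3;
pen memo `run/shared/lean/pub/bsd-addord/planner/g2_3f_enlarge/e19/README.md` v6 §4 (d), BRANCH BOOKKEEPING, PRINT-STATUS CHECK,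
ERRATUM (1)–(3)); consumer: brick E3′ of cruxes stmt-BirchSwinnertonDyer-19358 / -19357, step (d)
(`TameAnticycRestriction.exists_frame_and_restriction hB …`, `Socket`). HONEST FRAMING: TWO named facts (`def … : Prop`,
nothing asserted, no `_holds`; net debt +2, as the item asks); nothing about the cruxes or BSD is claimed.

## The configuration (S4‴) and why print applies — (π_g, ν·λ), NOT (π_{f_E}, λ)

(S4‴) `E = W/ℚ` elliptic, `f = f_E ∈ S₂(Γ₀(N))` (`IsNewformOf W f`); an odd prime `ℓ₀ ≠ p` with `ℓ₀ ∣ d_K` (RAMIFIED in `K`,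
`λ₀² = (ℓ₀)`) at which `E` is additive, potentially multiplicative of quadratic-twist type: `W₁ := E^{(ℓ₀*)}`,
`ℓ₀* = (−1)^{(ℓ₀−1)/2} ℓ₀`, has MULTIPLICATIVE reduction at `ℓ₀` (binder
`(W.quadraticTwist ℓ₀*).HasMultiplicativeReductionAtPrime ℓ₀` — the E3′ «twisted Wan prime» `TwistedWanPrime` of
`Cruxes/GordTwoRankOne/TwistedWanSketch.lean` without its curve-side clause `p ∤ v_{ℓ₀}(j)`); `E/K` NON-SPLIT multiplicative at
the prime `λ₀ ∣ ℓ₀` of `K` (binder `NonsplitOverAt`-shaped: `(W.baseChange K).HasMultiplicativeReductionAt v ∧ ¬ …Split…` at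
every `v ∋ ℓ₀`); every prime `ℓ ∣ N`, `ℓ ≠ ℓ₀`, SPLIT in `K`. The sibling's (S4′) ("`W` multiplicative, not split multiplicative at
`q ∥ N`") FAILS here (`E` additive at `ℓ₀`, `ℓ₀² ∣ N`: applied to `π_{f_E}` itself, `𝔫⁻ = ℓ₀²` is NOT square-free and (sf) fails),
so the two configurations are disjoint and nothing typed earlier is restated.
PRINT IS APPLIED TO `π = π_g`, `g := f_E ⊗ χ_{ℓ₀*}` the newform of `W₁` (level `N_g = N_{W₁}`, `ℓ₀ ∥ N_g`, the other primes of
`N_g` = the other primes of `N`, `a_ℓ(g) = χ_{ℓ₀*}(ℓ) a_ℓ(f_E)`), AND `λ_g := ν · λ` with `ν := χ_{ℓ₀*} ∘ N_{K/ℚ}` the GENUS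
character of `K` attached to `ℓ₀* ∥ d_K`: everywhere UNRAMIFIED (at `λ₀`: `K_{λ₀}(√ℓ₀*) = K_{λ₀}(√(d_K/ℓ₀*))`, `d_K/ℓ₀*` an
`ℓ₀`-adic unit), order `2`, `ν|_{𝔸_ℚ^×} = χ_{ℓ₀*}² = 1`, `ν(λ₀) = (d_K/ℓ₀* / ℓ₀)` (memo ERRATUM (1): "an everywhere-UNRAMIFIED
quadratic class-group character (conductor 1, ring class)"). BRANCH BOOKKEEPING (memo): `T_pE = T_pW₁ ⊗ χ_{ℓ₀*}`, and over `K`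
`χ_{ℓ₀*}|_{G_K} = ν`, so `π_{g,K} ⊗ νχ = π_{E,K} ⊗ χ` for every `χ`: "the anticyclotomic TRIVIAL branch of `E/K` (what the
frames `IsHsiehLFunction ι 𝔭 κ γ f_E …` describe …) IS the `ν`-branch of `g`". Hsieh's hypotheses for `(π_g, νλ)` [p. 3–4]:
`π_g` cuspidal with `ω = 1`, weight `2`; `νλ` of infinity type `(1, −1)` [p. 3 ll. 20–21] with `νλ|_{𝔸_ℚ^×} = ω⁻¹ = 1`, conductor
`𝔠_{νλ} = 𝔠_λ` (ν unramified — print allows ANY `𝔠_λ`, it enters only Thm. 2 (3)); (ord) ⟺ `p` split; `𝔫 = N_g`,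
`𝔫⁻ = λ₀`-part `= ℓ₀` (the only prime of `N_g` not split in `K`; ramified), so **(sf) "𝔫⁻ is square-free" [p. 4 l. 14] HOLDS**
(`ℓ₀ ∥ N_g`) and `π_{g,ℓ₀} = σ(μ₀|·|^{1/2}, μ₀|·|^{−1/2})` is the unramified special representation, `μ₀(ϖ) = a_{ℓ₀}(g) =
a_{ℓ₀}(W₁) ∈ {±1}` [p. 11 l. 2]; **Hypothesis 1 (= A) [p. 3 l. 22] ⟺ `E/K_{λ₀}` NON-SPLIT multiplicative**, by Hsieh's (R1)
[p. 11 ll. 3–4] ("For each `v ∈ A(χ)`, `v` is ramified in `𝓚` and `μ′_v χ_v(ϖ_v) = −1`", `μ′_v = μ_v ∘ N`): `λ₀ ∈ A(νλφ)` (`K_{λ₀}`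
a field, `π_{g,ℓ₀}` special, `νλφ` unramified at `λ₀`), `λ₀` IS ramified, `(λφ)_{λ₀} = 1` ([p. 23 l. 31]: "If `v` is inert or
ramified, then `φ_v = 1` as `φ_v` is unramified and `p > 2`", for every character through `Γ⁻`), `μ₀′(ϖ_{λ₀}) = a_{ℓ₀}(W₁)`
(residue degree `1`), `ν_{λ₀}(ϖ_{λ₀}) = ν(λ₀)`, so (R1) reads `a_{ℓ₀}(W₁) · ν(λ₀) = −1`, i.e. `a_{λ₀}(E/K) = −1` for
`E/K_{λ₀} = (W₁ ⊗ ν)/K_{λ₀}`, an UNRAMIFIED quadratic twist of the multiplicative `W₁/K_{λ₀}` — the binder. Theorem 2's extra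
hypotheses: (1) vacuous (`𝓕 = ℚ`); (2) `ρ̄_p(π_{g,K}) = ρ̄_{W₁,p}|_{G_K} = ρ̄_{E,p}|_{G_K} ⊗ ν̄` absolutely irreducible ⟺ the
binder on `E/K` (twist by a character), verbatim; (3) `p ∤ ∏_{v∣𝔠⁻_{νλ}} #Δ` vacuous: `𝔠_{νλ} = 𝔠_λ` is supported above the SPLIT
`p` (memo ERRATUM (1): "Hsieh Thm 2 condition (3) is vacuous"). `C(π_g, νλ) ∈ Z̄_{(p)}^×` as printed [p. 4 l. 18; p. 17 l. 5:
`(p, ℭ𝔫⁻) = (p, ℓ₀) = 1`]. Everything else ((S1)–(S3), (S6)–(S8), (W1)–(W4), (E1), (E1″), (E2), the `R₀`-unit period, `𝔑⁻ = λ₀`,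
`𝔑⁺ = ℭℭ̄` from the split primes, `𝔠(𝒪_K) = (c)` prime to `p𝔑𝔑̄`) is the sibling's reading for `(π_g, νλ)` in place of
`(π_f, λ)`, word for word.

## The currency: the EXISTING `f_E`-keyed frame, and the `λ₀`-LOCAL-FACTOR CAVEAT (memo ERRATUM (2); typer's choice (a))

The conclusion is typed, as the item prefers for the first cut, on the EXISTING frame `IsHsiehLFunction ι 𝔭 κ γ f_E A Ω_K C Ω_p Q`
(display `hsiehInterpolationValue p f_E 𝔭 χ n A Ω_K C`). Hsieh's element for `(π_g, νλ)` gives a frame for the display keyed to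
`(g, νχ)`; the two displays AGREE TERM BY TERM except at ONE Euler factor: (i) `cuspCoeff g p · (νχ)_𝔭(ϖ_𝔭) = χ_{ℓ₀*}(p) a_p(E) ·
ν(𝔭) χ_𝔭(ϖ_𝔭) = a_p(E) · χ_𝔭(ϖ_𝔭)` (`ν(𝔭) = χ_{ℓ₀*}(N𝔭) = χ_{ℓ₀*}(p)`, `p` split) and `((νχ)_𝔭(ϖ_𝔭))² = (χ_𝔭(ϖ_𝔭))²`, so the
`p`-Euler polynomial `(1 − a_p p⁻¹ x + e_p x²)²` and `ρ_p` agree (`p ∣ N_g ⟺ p ∣ N_E`); (ii) at every finite place `v ≠ λ₀` the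
naive factors `rankinSelbergLocalFactorInvHecke f_E χ v` and `… g (νχ) v` coincide (`N(v) = ℓ^k`: `α_g^k + β_g^k =
χ_{ℓ₀*}(ℓ)^k (α^k + β^k)` against `w = ν(v) χ(ϖ_v) = χ_{ℓ₀*}(ℓ)^k χ(ϖ_v)`, and `ν(v)² = 1`; `ℓ ∤ N_g ⟺ ℓ ∤ N_E` for
`ℓ ≠ ℓ₀`); (iii) at `v = λ₀` the `f_E`-keyed factor is `1` (`a_{ℓ₀}(f_E) = 0`, `ℓ₀ ∣ N_E`) while the honest `g`-keyed factor is
`1 − a_{ℓ₀}(g) ν(λ₀) χ(ϖ_{λ₀}) ℓ₀^{−s} = 1 + ℓ₀^{−s}` (non-split; `χ(ϖ_{λ₀}) = 1` on the range). Hence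
`rankinSelbergValueHecke f_E χ 1 = (1 + ℓ₀⁻¹) · rankinSelbergValueHecke g (νχ) 1` — the `f_E`-keyed value is the
`λ₀`-DEPLETED one (memo: "NOT equal as v5 claimed") — and `hsiehInterpolationValue p f_E 𝔭 χ n A Ω_K C = (1 + ℓ₀⁻¹) ·
[Hsieh's display for (g, νχ) with the same A, Ω_K, C]`. (This identity is a KERNEL statement about
`rankinSelbergLocalFactorInvHecke`, `BDPAnticyclotomicPAdicLFunction.lean` l. 176–215, recorded here as the reading; it is not
print.) CONSEQUENCE: with `Q := (1 + ℓ₀⁻¹) · Q_g ∈ 𝒪_{ℂ_p}⟦T⟧` (`(ℓ₀+1)/ℓ₀ ∈ ℤ_p`, `ℓ₀ ≠ p`), Theorem A's frame TRANSFERS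
with no further hypothesis (`thmA_…` below carries none); Theorem B's "a coefficient of norm one" (`μ = 0`) transfers iff
`‖(ℓ₀+1)/ℓ₀‖_p = 1`, i.e. iff `p ∤ ℓ₀ + 1` — the binder of `thmB_…` below (memo: "the existing `f_E`-keyed Hsieh frame therefore
serves the sub-row `p ∤ ℓ₀ + 1` … 1 428 / 1 460 r0 and 1 653 / 1 683 r1 strict rows"; the remaining rows need a `(g, ν)`-keyed
sibling predicate — NOT typed here). The factor cannot be moved into `C` (`‖ι⁻¹C‖ = 1`), `Ω_p` (a unit) or `A, Ω_K` (they enter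
with `n`-dependent powers).

WEAKER than print on its range (special case `𝓕 = ℚ`, `κ = 2`, `π = π_g` for `g` the `χ_{ℓ₀*}`-twist of `f_E`, branch `ν·λ`,
`𝔫⁻` = one ramified prime, unramified critical characters, consequence-shaped conclusions, the depleted `f_E`-keyed display),
never knowingly stronger. NOT typed, NOT asserted: the `(g, ν)`-keyed primitive frame; `Q ∈ R₀⟦T⟧`; any comparison with the
`IsBDPLFunction` / LZZ / JSW normalisations; `ℓ₀ = 2`; `ℓ₀` inert; the split genus class.
-- TODO(general form): as in the sibling (totally real `𝓕`, general `𝔫⁻`, `𝔠_λ⁻ ≠ (1)`), and the primitive `(g, ν)`-keyed frame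
-- serving the rows with `p ∣ ℓ₀ + 1`.

## References

* [Hsieh2014] M.-L. Hsieh, Doc. Math. 19 (2014) 709–767 = arXiv:1112.1580 (held, re-read for this file at the page:
  `[corpus: paper:arxiv-1112.1580 p0003 L14–L22]` (`𝔞 = 𝔞⁺𝔞⁻`, `ε*`, Hypothesis 1), `[p0003 L20–L21]` (infinity types of `π`, `λ`),
  `[p0004 L13–L18]` (Thm. 1 with (sf) and the display, `C(π,λ) ∈ Z̄_{(p)}^×`), `[p0004 L20–L22]` (`𝔫⁻` ramified in scope: "is
  constructed in [BDP]"), `[p0004 L30–L37]` (Thm. 2 (1)–(3)), `[p0011 L2–L4]` ((sf) ⟹ unramified special; (R1) "`v` is ramified in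
  `𝓚` and `μ′_v χ_v(ϖ_v) = −1`", right-hand side garbled in the held TeX, reconstructed as in the sibling), `[p0023 L31]` ("If `v`
  is inert or ramified, then `φ_v = 1`"), `[p0025 L54]` (Thm. 6.2)).
* [JacquetLanglands1970] Prop. 3.6; [Bump1997] (5.52)–(5.53); [SilvermanAEC2009] App. C §16 p. 449 (`a = −1` at non-split
  multiplicative primes) — as in the sibling.
* Pen memo e19 v6 (cell `pub/bsd-addord`): §4 (d), BRANCH BOOKKEEPING, PRINT-STATUS CHECK ("Hsieh 2014 on a BRANCH character: YES
  in print … λ a Hecke character of K of infinity type (k/2, −k/2) and ARBITRARY conductor"), ERRATUM (1)–(3).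
* Tree: the sibling `Hsieh2014/AnticyclotomicPAdicLFunctionRamifiedSteinberg.lean` and its references; `TwistedWanSketch.lean`
  (`TwistedWanPrime`, `NonsplitOverAt`, `BaseChangeNonsplit`); `DiophantineGeometry/LocalReduction.lean`
  (`HasMultiplicativeReductionAt`, `HasSplitMultiplicativeReductionAt` over `𝓞 K`).
-/

noncomputable section

open scoped MatrixGroups ModularForm Topology NumberField
open CongruenceSubgroup NumberField IsDedekindDomain Field
open Literature.NumberTheory.GaloisRepresentations
open Literature.NumberTheory.EllipticCurves.ModularForms
open Literature.NumberTheory.Automorphic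

namespace Literature.NumberTheory.EllipticCurves.Hsieh2014

/-! ### §1. Theorem A (= Thm. 1) for the `ν`-branch of `g = f_E ⊗ χ_{ℓ₀*}`, in the `f_E`-keyed frame -/

/-- **Hsieh, Doc. Math. 19 (2014), Theorem A (p. 712) = Thm. 1 [arXiv:1112.1580 pp. 3–4], WITH THE `p`-ADIC CM PERIOD IN
`𝒲^× = R₀^×`, AT ANY LEVEL AT `p`, APPLIED TO `(π_g, ν·λ)` FOR `E` ADDITIVE AT THE `K`-RAMIFIED PRIME `ℓ₀` WITH `E/K_{λ₀}`
NON-SPLIT MULTIPLICATIVE** — the named fact `thmA_exists_isHsiehLFunction_unrPeriod_ramifiedSteinberg` VERBATIM (same binders in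
the same order, same conclusion `∃ A Ω_K C Ω_p Q, 0 < A ∧ Ω_K ≠ 0 ∧ ‖ι⁻¹C‖ = 1 ∧ IsHsiehLFunction ι 𝔭 κ γ f A Ω_K C Ω_p Q`),
EXCEPT that the configuration (S4′) at `q` is REPLACED by (S4‴) of the module docstring at `ℓ₀`: `ℓ₀ ≠ p`, `ℓ₀ ≠ 2`,
`(ℓ₀ : ℤ) ∣ d_K` (ramified), `W₁ = W^{(ℓ₀*)}` MULTIPLICATIVE at `ℓ₀` (`E` additive of quadratic-twist type at `ℓ₀`), `E/K`
non-split multiplicative at every prime of `K` above `ℓ₀`, every `ℓ ∣ N` with `ℓ ≠ ℓ₀` split in `K`. Justification (module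
docstring): print is applied to `π_g`, `g = f_E ⊗ χ_{ℓ₀*}` (`ℓ₀ ∥ N_g`: (sf) holds) and `λ_g = ν·λ`, `ν` the everywhere-unramified
genus character (`𝔠_{νλ} = 𝔠_λ`); Hypothesis 1 at the unique place `λ₀ ∣ ℓ₀` ⟺ `a_{ℓ₀}(W₁)·ν(λ₀) = −1` ⟺ `E/K_{λ₀}` non-split
multiplicative, by (R1) [p. 11 ll. 3–4] and "`φ_v = 1`" [p. 23 l. 31]; the `(g, νχ)`-display equals `hsiehInterpolationValue p f_E
𝔭 χ n A Ω_K C` divided by the constant `1 + ℓ₀⁻¹` (the `f_E`-keyed Rankin–Selberg value is the `λ₀`-depleted one), so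
`Q := (1 + ℓ₀⁻¹)·Q_g ∈ 𝒪_{ℂ_p}⟦T⟧` serves — no further hypothesis for Theorem A. WEAKER than print (special case; depleted
display), never stronger; DISJOINT from (S4) and (S4′). NOT asserted: `Q ∈ R₀⟦T⟧`. Named fact; nothing asserted; no `_holds`.
[cite: Hsieh2014, Thm. A p. 712 (Doc. Math. 19) = Thm. 1 (arXiv:1112.1580 pp. 3–4), p. 3 ll. 14–22 (𝔫⁻, Hyp. 1), p. 4 ll. 13–22 ((sf); 𝔫⁻ ramified in scope), §3.5 (R1) (p. 11 ll. 1–4), proof of Lemma 5.4 (p. 23 l. 31), p. 17 l. 5]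
[cite: JacquetLanglands1970, Prop. 3.6] [cite: SilvermanAEC2009, App. C §16 p. 449 (L_v(T) = 1 + T at a prime of nonsplit multiplicative reduction)]
[cite: CastellaHsieh2018, §2.5 (arXiv:1505.08165 p. 7)] -/
def thmA_exists_isHsiehLFunction_unrPeriod_ramifiedTwistedSteinberg : Prop :=
  ∀ {p : ℕ} [Fact p.Prime] (ι : PadicAlgCl p ≃+* ℂ) (K : Type) [Field K] [NumberField K]
    (𝔭 : HeightOneSpectrum (𝓞 K)) (κ : ZpExtension K p) (γ : absoluteGaloisGroup K)
    {N : ℕ} [NeZero N] (W : WeierstrassCurve ℚ) [W.IsElliptic] (f : CuspForm (Gamma0 N) 2)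
    (ℓ₀ : ℕ) [Fact ℓ₀.Prime] (lam : HeckeCharacter K) (rlam : FramedGaloisRep K (PadicAlgCl p) 1),
    p ≠ 2 → IsNewformOf W f →
    IsImaginaryQuadratic K → ((Ideal.span {(p : ℤ)}).primesOver (𝓞 K)).ncard = 2 →
    ((p : ℕ) : 𝓞 K) ∈ 𝔭.asIdeal →
    (∀ (w : InfinitePlace K) (k : 𝓞 K), k ∈ 𝔭.asIdeal ↔ ‖ι.symm (w.embedding (k : K))‖ < 1) →
    -- (S4‴): `ℓ₀` odd, `≠ p`, RAMIFIED in `K`; `W₁ = W^{(ℓ₀*)}` multiplicative at `ℓ₀`; `E/K` NON-SPLIT multiplicative above `ℓ₀`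
    ℓ₀ ≠ p → ℓ₀ ≠ 2 → (ℓ₀ : ℤ) ∣ NumberField.discr K →
    (W.quadraticTwist (((-1 : ℤ) ^ (ℓ₀ / 2) * ℓ₀ : ℤ) : ℚ)).HasMultiplicativeReductionAtPrime ℓ₀ →
    (∀ v : HeightOneSpectrum (𝓞 K), ((ℓ₀ : ℕ) : 𝓞 K) ∈ v.asIdeal →
      (W.baseChange K).HasMultiplicativeReductionAt v ∧
        ¬ (W.baseChange K).HasSplitMultiplicativeReductionAt v) →
    (∀ ℓ : ℕ, ℓ.Prime → ℓ ∣ N → ℓ ≠ ℓ₀ → ((Ideal.span {(ℓ : ℤ)}).primesOver (𝓞 K)).ncard = 2) →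
    lam.IsUnitary → lam.HasInfinityType (fun _ ↦ (1 : ℤ)) (fun _ ↦ (-1 : ℤ)) →
    (∀ x : ideleGroup ℚ, lam (AdeleRing.ideleBaseChange ℚ K x) = 1) →
    (∀ v : HeightOneSpectrum (𝓞 K), ((p : ℕ) : 𝓞 K) ∉ v.asIdeal → lam.IsUnramifiedAt v) →
    IsPAdicAvatarOf ι lam rlam → FactorsThroughZp κ rlam →
    κ.IsAnticyclotomic → κ.IsTopGenerator γ →
    ∃ (A : ℝ) (ΩK C : ℂ) (Ωp : (unrIntegers p)ˣ) (Q : PowerSeries (PadicComplexInt p)),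
      0 < A ∧ ΩK ≠ 0 ∧ ‖((ι.symm C : PadicAlgCl p) : ℂ_[p])‖ = 1 ∧
        IsHsiehLFunction ι 𝔭 κ γ f A ΩK C ((Ωp : unrIntegers p) : ℂ_[p]) Q

/-! ### §2. Theorem B (= Thm. 2 = Thm. 6.2) for the `ν`-branch of `g`, in the `f_E`-keyed frame, first cut `p ∤ ℓ₀ + 1` -/

/-- **Hsieh, Doc. Math. 19 (2014), Theorem B (p. 713) = Thm. 2 [arXiv:1112.1580 p. 4 ll. 31–37] = Thm. 6.2 [p. 25], WITH THE
`p`-ADIC CM PERIOD IN `𝒲^× = R₀^×`, AT ANY LEVEL AT `p`, APPLIED TO `(π_g, ν·λ)` FOR `E` ADDITIVE AT THE `K`-RAMIFIED PRIME `ℓ₀`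
WITH `E/K_{λ₀}` NON-SPLIT MULTIPLICATIVE, ON THE FIRST CUT `p ∤ ℓ₀ + 1`** — the named fact
`thmB_exists_isHsiehLFunction_coeff_norm_eq_one_unrPeriod_ramifiedSteinberg` VERBATIM (same binders in the same order, same
conclusion: a frame `(A, Ω_K, C, Ω_p, Q)` with `IsHsiehLFunction ι 𝔭 κ γ f A Ω_K C Ω_p Q` AND a coefficient of `Q` of norm one),
EXCEPT that (S4′) is REPLACED by (S4‴) of the module docstring (`ℓ₀ ≠ p` odd, `ℓ₀ ∣ d_K`, `W^{(ℓ₀*)}` multiplicative at `ℓ₀`,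
`E/K` non-split multiplicative above `ℓ₀`, every other `ℓ ∣ N` split) AND the extra binder `¬ p ∣ ℓ₀ + 1`. Justification
(module docstring): Theorem 1's hypotheses for `(π_g, νλ)` as at `thmA_…_ramifiedTwistedSteinberg`; Theorem 2's (1) vacuous,
(2) = the binder "every framed mod-`p` representation of `E/K` is absolutely irreducible" (`ρ̄_{g}|_{G_K} = ρ̄_{E}|_{G_K} ⊗ ν̄`),
(3) vacuous (`𝔠_{νλ} = 𝔠_λ` above the split `p`; memo ERRATUM (1)); `μ⁻ = 0` gives a norm-one coefficient of `Q_g`, and the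
`f_E`-keyed `Q = (1 + ℓ₀⁻¹)·Q_g` keeps one iff `‖(ℓ₀+1)/ℓ₀‖_p = 1`, i.e. `p ∤ ℓ₀ + 1` (memo ERRATUM (2): the depleted display is
a UNIT multiple of the primitive one exactly on this cut; the other rows need a `(g, ν)`-keyed frame, not typed). WEAKER than
print (special case, depleted display, the cut), never stronger; DISJOINT from (S4) and (S4′). Named fact; nothing asserted; no `_holds`.
[cite: Hsieh2014, Thm. B p. 713 (Doc. Math. 19) = Thm. 2 (arXiv:1112.1580 p. 4 ll. 31–37), §3.5 (R1) (p. 11 ll. 1–4), proof of Lemma 5.4 (p. 23 l. 31), Thm. 6.1–6.2 (p. 25), Remark 6.4 (p. 26)]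
[cite: JacquetLanglands1970, Prop. 3.6] [cite: SilvermanAEC2009, App. C §16 p. 449 (L_v(T) = 1 + T at a prime of nonsplit multiplicative reduction)] [cite: CastellaHsieh2018, §2.5 (arXiv:1505.08165 p. 7)] -/
def thmB_exists_isHsiehLFunction_coeff_norm_eq_one_unrPeriod_ramifiedTwistedSteinberg : Prop :=
  ∀ {p : ℕ} [Fact p.Prime] (ι : PadicAlgCl p ≃+* ℂ) (K : Type) [Field K] [NumberField K]
    (𝔭 : HeightOneSpectrum (𝓞 K)) (κ : ZpExtension K p) (γ : absoluteGaloisGroup K)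
    {N : ℕ} [NeZero N] (W : WeierstrassCurve ℚ) [W.IsElliptic] (f : CuspForm (Gamma0 N) 2)
    (ℓ₀ : ℕ) [Fact ℓ₀.Prime] (lam : HeckeCharacter K) (rlam : FramedGaloisRep K (PadicAlgCl p) 1),
    p ≠ 2 → IsNewformOf W f →
    IsImaginaryQuadratic K → ((Ideal.span {(p : ℤ)}).primesOver (𝓞 K)).ncard = 2 →
    ((p : ℕ) : 𝓞 K) ∈ 𝔭.asIdeal →
    (∀ (w : InfinitePlace K) (k : 𝓞 K), k ∈ 𝔭.asIdeal ↔ ‖ι.symm (w.embedding (k : K))‖ < 1) →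
    -- (S4‴) and the first-cut binder `p ∤ ℓ₀ + 1`
    ℓ₀ ≠ p → ℓ₀ ≠ 2 → (ℓ₀ : ℤ) ∣ NumberField.discr K →
    (W.quadraticTwist (((-1 : ℤ) ^ (ℓ₀ / 2) * ℓ₀ : ℤ) : ℚ)).HasMultiplicativeReductionAtPrime ℓ₀ →
    (∀ v : HeightOneSpectrum (𝓞 K), ((ℓ₀ : ℕ) : 𝓞 K) ∈ v.asIdeal →
      (W.baseChange K).HasMultiplicativeReductionAt v ∧
        ¬ (W.baseChange K).HasSplitMultiplicativeReductionAt v) →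
    (∀ ℓ : ℕ, ℓ.Prime → ℓ ∣ N → ℓ ≠ ℓ₀ → ((Ideal.span {(ℓ : ℤ)}).primesOver (𝓞 K)).ncard = 2) →
    ¬ p ∣ ℓ₀ + 1 →
    (∀ ρ : ModPGaloisRep K (ZMod p) 2, (W.baseChange K).IsTorsionGaloisRep p ρ →
      FramedRep.IsAbsolutelyIrreducible ρ) →
    lam.IsUnitary → lam.HasInfinityType (fun _ ↦ (1 : ℤ)) (fun _ ↦ (-1 : ℤ)) →
    (∀ x : ideleGroup ℚ, lam (AdeleRing.ideleBaseChange ℚ K x) = 1) →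
    (∀ v : HeightOneSpectrum (𝓞 K), ((p : ℕ) : 𝓞 K) ∉ v.asIdeal → lam.IsUnramifiedAt v) →
    IsPAdicAvatarOf ι lam rlam → FactorsThroughZp κ rlam →
    κ.IsAnticyclotomic → κ.IsTopGenerator γ →
    ∃ (A : ℝ) (ΩK C : ℂ) (Ωp : (unrIntegers p)ˣ) (Q : PowerSeries (PadicComplexInt p)),
      0 < A ∧ ΩK ≠ 0 ∧ ‖((ι.symm C : PadicAlgCl p) : ℂ_[p])‖ = 1 ∧
        IsHsiehLFunction ι 𝔭 κ γ f A ΩK C ((Ωp : unrIntegers p) : ℂ_[p]) Q ∧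
        ∃ n : ℕ, ‖((PowerSeries.coeff n Q : PadicComplexInt p) : ℂ_[p])‖ = 1

end Literature.NumberTheory.EllipticCurves.Hsieh2014

end
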